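import Literature.AlgebraicGeometry.Resolution.ArithmeticalThreefoldsCompletionValuesIso
import HarnessLib

/-!
# Cossart–Piltant 2019, Prop. 4.8: rational-rank relations along the extension `v̂`

Topic: `Literature/AlgebraicGeometry/Resolution` (proofs only; no new notions, no new named
facts). Continuation of `ArithmeticalThreefoldsCompletionValues{,Iso}.lean`. In the proof of
Cossart–Piltant's descent from the formal completion (J. Algebra 529 (2019) = arXiv:1412.0868,
journal Prop. 4.8 = arXiv v1 Prop. 4.6, p. 53) the loop `♯E ≤ r` of Lemma 4.7 (= [CoP1]
Prop. 8.1) runs along the extension `v̂` of the rank-one valuation `v` (rational rank `r`) to the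
formal branch `K̂₁`, and needs, whenever more than `r` regular parameters divide `h ∈ A`, a
non-trivial multiplicative relation among their `v̂`-values ("In particular
`v̂(û₁), …, v̂(û_r) ∈ Γ_v ⊗ ℚ`"). The rational rank of `v̂` itself is in general larger than `r`;
what makes the relation available is that such parameters lie in the local rings of a model with
`K`-finite denominators and have values bounded by `v(h)`, hence values of elements of `K`:

* `exists_valuation_eq_of_mem_locAtCentre_of_le` — an element of `locAtCentre C O'` (`C` a ring
  of fractions with `K`-finite denominators) whose value is bounded by the value of a non-zero
  element of `K` has the value of a non-zero element of `K` (dichotomy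
  `valuation_adicCompletion_eq_or_lt` for numerator and denominator);
* `exists_rel_valuation_of_forall_eq` — a supplier of relations among the `v`-values of any
  `> r` non-zero elements of `K` yields one among the `v̂`-values of any `> r` elements of `K̂₁`
  each having the value of a non-zero element of `K`;
* `exists_rel_valuation_of_mem_locAtCentre_of_le` — the two combined: the restricted supplier
  `hdep` of `exists_frameStepsTracked_card_supp_le_subset_within` /
  `head_conclusion_of_principalized_within'` along `v̂`, for `C` with `K`-finite denominators and a
  `K`-finite `F`, from the rank data of `v` on `K`.

## Sources

* V. Cossart, O. Piltant, J. Algebra 529 (2019) 268–535 = arXiv:1412.0868, proof of Prop. 4.8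
  with Lemma 4.7 (arXiv v1: Prop. 4.6, p. 53). [CossartPiltant2019]
* V. Cossart, O. Piltant, J. Algebra 320 (2008) 1051–1082: proof of Prop. 8.1 (HAL
  hal-00139124, p. 23). [CossartPiltant2008]
-/

noncomputable section

namespace Literature.AlgebraicGeometry.Resolution

universe u v w

open IsLocalRing

variable {A : Type u} [CommRing A] [IsLocalRing A] [IsNoetherianRing A]
  {K : Type v} [Field K] [Algebra A K]

/-- **Values bounded by a `K`-value are `K`-values, on a ring with `K`-finite denominators.** In
the situation of `valuation_adicCompletion_eq_or_lt` (`(A, 𝔪)` Noetherian local, `O` a rank-one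
valuation ring of `K ⊇ A` centred on `𝔪`, `ι : K → K̂₁` compatible with `A → Â → K̂₁`, `O' ⊇ Â`
a valuation ring of `K̂₁` with `O' ∩ K = O`), let `C` be a subring of `K̂₁` whose elements are
fractions `x/e`, `x, e ∈ Â`, with `e` `K`-finite. If `y ∈ locAtCentre C O'` has
`v̂(y) ≤ v(b)` (Mathlib order: `valuation (ι b) ≤ valuation y`) for some `b ∈ K^×`, then
`v̂(y) = v̂(ι a)` for some `a ∈ K^×`: writing `y = (x₁e₂)/(e₁x₂)` with `e₁x₂` `K`-finite, the
dichotomy gives `v̂(e₁x₂) = v(a₂)`, and then `v̂(x₁e₂) ≤ v(b a₂)` is `K`-finite too. (In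
Cossart–Piltant: the parameters dividing `h` have values in `Γ_v`.)
[cite: CossartPiltant2019, proof of Prop. 4.8 with Lemma 4.7 (arXiv v1: Prop. 4.6, p. 53)] -/
theorem exists_valuation_eq_of_mem_locAtCentre_of_le (O : ValuationSubring K)
    (hrk : Nonempty O.valuation.RankOne) (hAO : ∀ x : A, algebraMap A K x ∈ O)
    (hdom : ∀ x ∈ maximalIdeal A, O.valuation (algebraMap A K x) < 1)
    {K₁ : Type w} [Field K₁] [Algebra (AdicCompletion (maximalIdeal A) A) K₁]
    (ι : K →+* K₁) (hι : ι.comp (algebraMap A K) =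
      (algebraMap (AdicCompletion (maximalIdeal A) A) K₁).comp
        (algebraMap A (AdicCompletion (maximalIdeal A) A)))
    (O' : ValuationSubring K₁)
    (hRO' : ∀ x : AdicCompletion (maximalIdeal A) A, algebraMap _ K₁ x ∈ O')
    (hO : O'.comap ι = O) (C : Subring K₁)
    (hC : ∀ y ∈ C, ∃ x e : AdicCompletion (maximalIdeal A) A,
      (∃ b : K, b ≠ 0 ∧ O'.valuation (ι b) ≤ O'.valuation (algebraMap _ K₁ e)) ∧
        y * algebraMap _ K₁ e = algebraMap _ K₁ x)
    {y : K₁} (hy : y ∈ locAtCentre C O') {b : K} (hb : b ≠ 0)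
    (hyb : O'.valuation (ι b) ≤ O'.valuation y) :
    ∃ a : K, a ≠ 0 ∧ O'.valuation y = O'.valuation (ι a) := by
  classical
  have hιA : ∀ a : A, algebraMap (AdicCompletion (maximalIdeal A) A) K₁
      (algebraMap A (AdicCompletion (maximalIdeal A) A) a) = ι (algebraMap A K a) := fun a => by
    have := RingHom.congr_fun hι a
    simpa only [RingHom.comp_apply] using this.symm
  have hpos : ∀ b : K, b ≠ 0 → 0 < O'.valuation (ι b) := fun b hb =>
    zero_lt_iff.mpr ((Valuation.ne_zero_iff _).mpr ((map_ne_zero ι).mpr hb))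
  -- an element of `Â` whose value is at least a `K`-value has a `K`-value
  have hfin : ∀ (z : AdicCompletion (maximalIdeal A) A) (b : K), b ≠ 0 →
      O'.valuation (ι b) ≤ O'.valuation (algebraMap _ K₁ z) →
      ∃ a : K, a ≠ 0 ∧ O'.valuation (algebraMap _ K₁ z) = O'.valuation (ι a) := by
    intro z b hb hbz
    rcases valuation_adicCompletion_eq_or_lt O hrk hAO hdom ι hι O' hRO' hO z with ⟨a, ha⟩ | h
    · refine ⟨algebraMap A K a, fun ha0 => ?_, ha⟩
      rw [ha, ha0, map_zero, map_zero] at hbz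
      exact not_lt.mpr hbz (hpos b hb)
    · exact absurd (h b hb) (not_lt.mpr hbz)
  obtain ⟨y₁, hy₁, y₂, hy₂, hv₂, rfl⟩ := hy
  obtain ⟨x₁, e₁, ⟨b₁, hb₁, hbe₁⟩, h₁⟩ := hC y₁ hy₁
  obtain ⟨x₂, e₂, ⟨b₂, hb₂, hbe₂⟩, h₂⟩ := hC y₂ hy₂
  have he₁ : algebraMap (AdicCompletion (maximalIdeal A) A) K₁ e₁ ≠ 0 := fun h0 => by
    rw [h0, map_zero] at hbe₁; exact not_lt.mpr hbe₁ (hpos b₁ hb₁)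
  have he₂ : algebraMap (AdicCompletion (maximalIdeal A) A) K₁ e₂ ≠ 0 := fun h0 => by
    rw [h0, map_zero] at hbe₂; exact not_lt.mpr hbe₂ (hpos b₂ hb₂)
  have hy₂0 : y₂ ≠ 0 := ne_zero_of_valuation_eq_one hv₂
  -- the denominator `e₁ x₂` is `K`-finite, hence has a `K`-value `v(a₂)`
  have hx₂val : O'.valuation (algebraMap _ K₁ x₂) =
      O'.valuation (algebraMap (AdicCompletion (maximalIdeal A) A) K₁ e₂) := by
    rw [← h₂, map_mul, hv₂, one_mul]
  have hden : O'.valuation (ι (b₁ * b₂)) ≤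
      O'.valuation (algebraMap (AdicCompletion (maximalIdeal A) A) K₁ (e₁ * x₂)) := by
    rw [map_mul, map_mul, map_mul, map_mul, hx₂val]
    exact mul_le_mul' hbe₁ hbe₂
  obtain ⟨a₂, ha₂, hva₂⟩ := hfin (e₁ * x₂) (b₁ * b₂) (mul_ne_zero hb₁ hb₂) hden
  -- `y = (x₁ e₂) / (e₁ x₂)`
  have hx₂0 : algebraMap (AdicCompletion (maximalIdeal A) A) K₁ x₂ ≠ 0 := by
    rw [← h₂]; exact mul_ne_zero hy₂0 he₂
  have hden0 : algebraMap (AdicCompletion (maximalIdeal A) A) K₁ (e₁ * x₂) ≠ 0 := by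
    rw [map_mul]; exact mul_ne_zero he₁ hx₂0
  have heq : y₁ / y₂ * algebraMap (AdicCompletion (maximalIdeal A) A) K₁ (e₁ * x₂) =
      algebraMap _ K₁ (x₁ * e₂) := by
    rw [map_mul, map_mul, ← h₁, ← h₂]
    field_simp
  -- the numerator `x₁ e₂` has value `v̂(y) v(a₂) ≤ v(b a₂)`, hence a `K`-value `v(a₁)`
  have hvprod : O'.valuation (y₁ / y₂ * algebraMap (AdicCompletion (maximalIdeal A) A) K₁
      (e₁ * x₂)) = O'.valuation (y₁ / y₂) * O'.valuation (ι a₂) := by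
    rw [(O'.valuation).map_mul, hva₂]
  have hnum : O'.valuation (ι (b * a₂)) ≤
      O'.valuation (algebraMap (AdicCompletion (maximalIdeal A) A) K₁ (x₁ * e₂)) := by
    rw [← heq, hvprod, ι.map_mul, (O'.valuation).map_mul]
    exact mul_le_mul' hyb le_rfl
  obtain ⟨a₁, ha₁, hva₁⟩ := hfin (x₁ * e₂) (b * a₂) (mul_ne_zero hb ha₂) hnum
  refine ⟨a₁ / a₂, div_ne_zero ha₁ ha₂, ?_⟩
  have hι₂ : O'.valuation (ι a₂) ≠ 0 := (Valuation.ne_zero_iff _).mpr ((map_ne_zero ι).mpr ha₂)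
  have hvy : O'.valuation (y₁ / y₂) * O'.valuation (ι a₂) = O'.valuation (ι a₁) := by
    rw [← hva₁, ← heq, hvprod]
  calc O'.valuation (y₁ / y₂)
      = O'.valuation (y₁ / y₂) * O'.valuation (ι a₂) / O'.valuation (ι a₂) := by
        rw [mul_div_cancel_right₀ _ hι₂]
    _ = O'.valuation (ι a₁) / O'.valuation (ι a₂) := by rw [hvy]
    _ = O'.valuation (ι (a₁ / a₂)) := by rw [map_div₀ ι, map_div₀]

omit [IsLocalRing A] [IsNoetherianRing A] in
/-- **Relations among `K`-values transfer to `K̂₁`.** Let `ι : K → K̂₁` and `O' ∩ K = O`. If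
every family of more than `r` non-zero elements of `K` admits a non-trivial multiplicative
relation among its `v`-values (the rational rank of `v` is `≤ r`; the output of
`exists_rank_data`), then so does every family `y` of non-zero elements of `K̂₁` indexed inside
`Fin d` whose members indexed in `I`, `♯I > r`, have the `v̂`-values of non-zero elements of `K`.
[cite: CossartPiltant2019, proof of Prop. 4.8 with Lemma 4.7 (arXiv v1: Prop. 4.6, p. 53)] -/
theorem exists_rel_valuation_of_forall_eq (O : ValuationSubring K)
    {K₁ : Type w} [Field K₁] (ι : K →+* K₁) (O' : ValuationSubring K₁) (hO : O'.comap ι = O)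
    (r : ℕ)
    (hdepK : ∀ (d : ℕ) (I : Finset (Fin d)) (a : Fin d → K), r < I.card → (∀ k, a k ≠ 0) →
      ∃ c : Fin d → ℤ, (∀ k, k ∉ I → c k = 0) ∧ c ≠ 0 ∧
        ∏ k, O.valuation (a k) ^ (c k).toNat = ∏ k, O.valuation (a k) ^ (-c k).toNat)
    {d : ℕ} (I : Finset (Fin d)) (y : Fin d → K₁) (hI : r < I.card)
    (hyK : ∀ k ∈ I, ∃ a : K, a ≠ 0 ∧ O'.valuation (y k) = O'.valuation (ι a)) :
    ∃ c : Fin d → ℤ, (∀ k, k ∉ I → c k = 0) ∧ c ≠ 0 ∧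
      ∏ k, O'.valuation (y k) ^ (c k).toNat = ∏ k, O'.valuation (y k) ^ (-c k).toNat := by
  classical
  have hequiv : O.valuation.IsEquiv (O'.valuation.comap ι) := by
    rw [Valuation.isEquiv_iff_valuationSubring, ValuationSubring.valuationSubring_valuation]
    ext z
    rw [Valuation.mem_valuationSubring_iff, Valuation.comap_apply,
      ValuationSubring.valuation_le_one_iff, ← ValuationSubring.mem_comap, hO]
  -- choose `a_k ∈ K^×` with `v̂(y_k) = v̂(ι a_k)` for `k ∈ I`, and `a_k = 1` otherwise
  have hchoice : ∀ k, ∃ a : K, a ≠ 0 ∧ (k ∈ I → O'.valuation (y k) = O'.valuation (ι a)) := by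
    intro k
    by_cases hk : k ∈ I
    · obtain ⟨a, ha, hva⟩ := hyK k hk
      exact ⟨a, ha, fun _ => hva⟩
    · exact ⟨1, one_ne_zero, fun h => absurd h hk⟩
  choose a ha hva using hchoice
  obtain ⟨c, hcI, hc0, hrel⟩ := hdepK d I a hI ha
  refine ⟨c, hcI, hc0, ?_⟩
  -- transport the relation along `ι` (equivalent valuations) and substitute the values
  have hrel' : O'.valuation (ι (∏ k, a k ^ (c k).toNat)) =
      O'.valuation (ι (∏ k, a k ^ (-c k).toNat)) := by
    have h1 : O.valuation (∏ k, a k ^ (c k).toNat) = O.valuation (∏ k, a k ^ (-c k).toNat) := by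
      rw [map_prod, map_prod]
      simp_rw [map_pow]
      exact hrel
    have h2 := (hequiv.eq_iff).mp h1
    simpa only [Valuation.comap_apply] using h2
  rw [map_prod, map_prod, map_prod, map_prod] at hrel'
  simp_rw [map_pow] at hrel'
  have hfac : ∀ (s : Fin d → ℕ), (∀ k, k ∉ I → s k = 0) →
      ∏ k, O'.valuation (y k) ^ s k = ∏ k, O'.valuation (ι (a k)) ^ s k := by
    intro s hs
    refine Finset.prod_congr rfl fun k _ => ?_
    by_cases hk : k ∈ I
    · rw [hva k hk]
    · rw [hs k hk, pow_zero, pow_zero]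
  rw [hfac (fun k => (c k).toNat) (fun k hk => by rw [hcI k hk]; rfl),
    hfac (fun k => (-c k).toNat) (fun k hk => by rw [hcI k hk]; rfl)]
  exact hrel'

/-- **The restricted supplier of relations along `v̂`** — the hypothesis `hdep` of
`exists_frameStepsTracked_card_supp_le_subset_within` / `head_conclusion_of_principalized_within'`
in Cossart–Piltant 2019's descent. In the situation of `valuation_adicCompletion_eq_or_lt`, let
`C ⊆ K̂₁` have `K`-finite denominators and let `F ∈ K̂₁` have value at most a `K`-value
(`v̂(ι b) ≤ v̂(F)`, `b ∈ K^×`; in the source `F` is a multiple of `ι(h)`, `h ∈ A`, in a ring with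
`K`-finite denominators). If the rational rank of `v` on `K` is `≤ r` (relations among any `> r`
values, `exists_rank_data`), then every family `y` of non-zero elements of `K̂₁` whose members
indexed in `I`, `♯I > r`, lie in `locAtCentre C O'` with `v̂(F) ≤ v̂(y_k)` admits a non-trivial
relation supported on `I`: such `y_k` have `K`-values
(`exists_valuation_eq_of_mem_locAtCentre_of_le`), and relations transfer
(`exists_rel_valuation_of_forall_eq`). [cite: CossartPiltant2019, proof of Prop. 4.8 with
Lemma 4.7 (arXiv v1: Prop. 4.6, p. 53)] [cite: CossartPiltant2008, proof of Prop. 8.1 (HAL p. 23)] -/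
theorem exists_rel_valuation_of_mem_locAtCentre_of_le (O : ValuationSubring K)
    (hrk : Nonempty O.valuation.RankOne) (hAO : ∀ x : A, algebraMap A K x ∈ O)
    (hdom : ∀ x ∈ maximalIdeal A, O.valuation (algebraMap A K x) < 1)
    {K₁ : Type w} [Field K₁] [Algebra (AdicCompletion (maximalIdeal A) A) K₁]
    (ι : K →+* K₁) (hι : ι.comp (algebraMap A K) =
      (algebraMap (AdicCompletion (maximalIdeal A) A) K₁).comp
        (algebraMap A (AdicCompletion (maximalIdeal A) A)))
    (O' : ValuationSubring K₁)
    (hRO' : ∀ x : AdicCompletion (maximalIdeal A) A, algebraMap _ K₁ x ∈ O')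
    (hO : O'.comap ι = O) (C : Subring K₁)
    (hC : ∀ y ∈ C, ∃ x e : AdicCompletion (maximalIdeal A) A,
      (∃ b : K, b ≠ 0 ∧ O'.valuation (ι b) ≤ O'.valuation (algebraMap _ K₁ e)) ∧
        y * algebraMap _ K₁ e = algebraMap _ K₁ x)
    {F : K₁} (hF : ∃ b : K, b ≠ 0 ∧ O'.valuation (ι b) ≤ O'.valuation F)
    (r : ℕ)
    (hdepK : ∀ (d : ℕ) (I : Finset (Fin d)) (a : Fin d → K), r < I.card → (∀ k, a k ≠ 0) →
      ∃ c : Fin d → ℤ, (∀ k, k ∉ I → c k = 0) ∧ c ≠ 0 ∧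
        ∏ k, O.valuation (a k) ^ (c k).toNat = ∏ k, O.valuation (a k) ^ (-c k).toNat)
    {d : ℕ} (I : Finset (Fin d)) (y : Fin d → K₁) (hI : r < I.card) (hy0 : ∀ k, y k ≠ 0)
    (hyC : ∀ k ∈ I, y k ∈ locAtCentre C O' ∧ O'.valuation F ≤ O'.valuation (y k)) :
    ∃ c : Fin d → ℤ, (∀ k, k ∉ I → c k = 0) ∧ c ≠ 0 ∧
      ∏ k, O'.valuation (y k) ^ (c k).toNat = ∏ k, O'.valuation (y k) ^ (-c k).toNat := by
  have _ := hy0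
  obtain ⟨b, hb, hbF⟩ := hF
  refine exists_rel_valuation_of_forall_eq O ι O' hO r hdepK I y hI fun k hk => ?_
  obtain ⟨hkC, hFk⟩ := hyC k hk
  exact exists_valuation_eq_of_mem_locAtCentre_of_le O hrk hAO hdom ι hι O' hRO' hO C hC hkC hb
    (hbF.trans hFk)

end Literature.AlgebraicGeometry.Resolution

end
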